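import Mathlib
import Summits.Ventures.PercRepro2.SwOutCrossGenDefs

/-!
# The generic cross-arm cube: the core part (blind cell PercRepro2, night-4 g23, 2026-08-28;
proofs/NIGHT4-G23.md §8)

For each core fibre point `w` the set `D w = {s | (s, label w) ∈ 𝒯}` is a lower set of the u-arm
cube, `ER (·, w)` is increasing, the cube principle gives
`#(D w ∩ {ER (·, w) ∈ 𝓔}) ≤ #(D w ∩ {ER (flipAll ·, w) ∈ 𝓔})`, and the rearrangement along each
pair `(w, flip w)` of core points (`D (flip w) ⊆ D w`, `ER (·, w) ⊆ ER (·, flip w)`) turns the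
same-fibre right-hand sides into the flipped-fibre ones: **`pair_card_le`**.
-/

namespace Summit.Ventures.PercRepro2

namespace CrossArm

open LocRows

variable {W A L : Type*} {F : FibreData W A L} {ι : Type*}

open scoped Classical

section Mono

/-- `redUG` is monotone. -/
lemma redUG_mono {s s' : Config ι} (h : s ≤ s') (hs : redUG s) : redUG s' := by
  obtain ⟨j, hj⟩ := hs
  exact ⟨j, Bool.le_iff_imp.1 (h j) hj⟩

/-- `ERG` is monotone in the u-arm bits for a fixed fibre point. -/
lemma ERG_mono {s s' : Config ι} (h : s ≤ s') (w : W) : ERG F (s, w) ⊆ ERG F (s', w) := by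
  intro a ha
  rcases a with j | _ | a
  · exact Bool.le_iff_imp.1 (h j) ha
  · exact redUG_mono h ha
  · exact ⟨redUG_mono h ha.1, ha.2⟩

/-- `ERG` is monotone in the red fibre atoms for a fixed `s`. -/
lemma ERG_mono_fib (s : Config ι) {w w' : W} (h : ∀ a, F.red w a = true → F.red w' a = true) :
    ERG F (s, w) ⊆ ERG F (s, w') := by
  intro a ha
  rcases a with j | _ | a
  · exact ha
  · exact ha
  · exact ⟨ha.1, h a ha.2⟩

/-- `flipAll` is antitone. -/
lemma flipAll_antitoneG {s s' : Config ι} (h : s ≤ s') : flipAll s' ≤ flipAll s := by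
  intro j
  have := h j
  unfold flipAll
  cases hs : s j <;> cases hs' : s' j <;> simp_all

/-- `EBG` is `ERG` of the flip, spelled out. -/
lemma EBG_eq (s : Config ι) (w : W) : EBG F (s, w) = ERG F (flipAll s, F.flip w) := rfl

end Mono

section Core

variable (F) (𝒯 : Set (TypG L ι)) (𝓔 : Set (Set (AtomG A ι)))

/-- The u-arm bits at which the fibre point `w` lies in `𝒯`. -/
def DG (w : W) : Set (Config ι) := {s | (s, F.label w) ∈ 𝒯}

/-- The u-arm bits at which `ERG F (·, w)` lies in `𝓔`. -/
def AG (w : W) : Set (Config ι) := {s | ERG F (s, w) ∈ 𝓔}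

/-- The u-arm bits at which `ERG F (flipAll ·, w)` lies in `𝓔`. -/
def FlG (w : W) : Set (Config ι) := flipAll ⁻¹' AG F 𝓔 w

variable {F 𝒯 𝓔}

/-- `DG w` is a lower set. -/
lemma isLowerSet_DG (h𝒯 : IsUpG F 𝒯) (w : W) : IsLowerSet (DG F 𝒯 w) := by
  intro s s' hle hs
  refine h𝒯 _ hs _ ⟨fun j hj => ?_, F.betterL_refl _⟩
  have := hle j
  simp only at hj ⊢
  rw [hj] at this
  cases h' : s' j with
  | false => rfl
  | true =>
    rw [h'] at this
    exact absurd (Bool.le_iff_imp.1 this rfl) (by decide)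

/-- `AG w` is an up-set. -/
lemma isUpperSet_AG (h𝓔 : IsUpperSet 𝓔) (w : W) : IsUpperSet (AG F 𝓔 w) :=
  fun _ _ hle hs => h𝓔 (ERG_mono hle w) hs

/-- `FlG w` is a lower set. -/
lemma isLowerSet_FlG (h𝓔 : IsUpperSet 𝓔) (w : W) : IsLowerSet (FlG F 𝓔 w) :=
  fun _ _ hle hs => isUpperSet_AG h𝓔 w (flipAll_antitoneG hle) hs

/-- The flip exchanges `AG w` and `FlG w`. -/
lemma flipAll_preimage_FlG (w : W) : flipAll ⁻¹' FlG F 𝓔 w = AG F 𝓔 w := by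
  ext s
  simp only [FlG, Set.mem_preimage, flipAll_involutive s]

/-- `DG (flip w) ⊆ DG w` for a lower core point. -/
lemma DG_flip_subset (h𝒯 : IsUpG F 𝒯) {w : W} (hw : w ∈ F.core0) :
    DG F 𝒯 (F.flip w) ⊆ DG F 𝒯 w := fun _ hs =>
  h𝒯 _ hs _ ⟨fun _ h => h, F.pair_label w hw⟩

/-- `FlG w ⊆ FlG (flip w)` for a lower core point. -/
lemma FlG_subset_flip (h𝓔 : IsUpperSet 𝓔) {w : W} (hw : w ∈ F.core0) :
    FlG F 𝓔 w ⊆ FlG F 𝓔 (F.flip w) := fun _ hs =>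
  h𝓔 (ERG_mono_fib _ (F.pair_red w hw)) hs

variable [Fintype ι] [DecidableEq ι]

/-- **The cube principle on a fibre point**: `#(DG w ∩ AG w) ≤ #(DG w ∩ FlG w)`. -/
theorem card_DG_AG_le (h𝒯 : IsUpG F 𝒯) (h𝓔 : IsUpperSet 𝓔) (w : W) :
    (Finset.univ.filter (· ∈ DG F 𝒯 w ∩ AG F 𝓔 w)).card ≤
      (Finset.univ.filter (· ∈ DG F 𝒯 w ∩ FlG F 𝓔 w)).card :=
  card_inter_le_of_cube (isLowerSet_DG h𝒯 w) (isUpperSet_AG h𝓔 w) (isLowerSet_FlG h𝓔 w)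
    (flipAll_preimage_FlG w)

/-- The rearrangement: for `D' ⊆ D` and `F ⊆ F'`,
`#(D ∩ F) + #(D' ∩ F') ≤ #(D ∩ F') + #(D' ∩ F)`. -/
lemma card_rearrG {α : Type*} [Fintype α] {D D' E E' : Set α} (hD : D' ⊆ D) (hE : E ⊆ E') :
    (Finset.univ.filter (· ∈ D ∩ E)).card + (Finset.univ.filter (· ∈ D' ∩ E')).card ≤
      (Finset.univ.filter (· ∈ D ∩ E')).card + (Finset.univ.filter (· ∈ D' ∩ E)).card := by
  have split : ∀ X : Set α, X ⊆ D → (Finset.univ.filter (· ∈ X ∩ E')).card =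
      (Finset.univ.filter (· ∈ X ∩ E)).card + (Finset.univ.filter (· ∈ X ∩ (E' \ E))).card := by
    intro X _
    rw [← Finset.card_union_of_disjoint]
    · congr 1
      ext x
      simp only [Finset.mem_filter, Finset.mem_univ, true_and, Finset.mem_union, Set.mem_inter_iff,
        Set.mem_sdiff]
      constructor
      · rintro ⟨hx, hx'⟩
        by_cases hE' : x ∈ E
        · exact Or.inl ⟨hx, hE'⟩
        · exact Or.inr ⟨hx, hx', hE'⟩
      · rintro (⟨hx, hx'⟩ | ⟨hx, hx', -⟩)
        · exact ⟨hx, hE hx'⟩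
        · exact ⟨hx, hx'⟩
    · rw [Finset.disjoint_left]
      intro x hx hx'
      simp only [Finset.mem_filter, Finset.mem_univ, true_and, Set.mem_inter_iff,
        Set.mem_sdiff] at hx hx'
      exact hx'.2.2 hx.2
  have h1 := split D (le_refl _)
  have h2 := split D' hD
  have h3 : (Finset.univ.filter (· ∈ D' ∩ (E' \ E))).card ≤
      (Finset.univ.filter (· ∈ D ∩ (E' \ E))).card := by
    apply Finset.card_le_card
    intro x hx
    simp only [Finset.mem_filter, Finset.mem_univ, true_and, Set.mem_inter_iff] at hx ⊢
    exact ⟨hD hx.1, hx.2⟩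
  omega

/-- **The paired core inequality**: for a lower core point `w`, the two cube counts of `w` and its
flip, with the same fibre on the right, are at most the two counts with the flipped fibre. -/
theorem pair_card_le (h𝒯 : IsUpG F 𝒯) (h𝓔 : IsUpperSet 𝓔) {w : W} (hw : w ∈ F.core0) :
    (Finset.univ.filter (· ∈ DG F 𝒯 w ∩ AG F 𝓔 w)).card +
      (Finset.univ.filter (· ∈ DG F 𝒯 (F.flip w) ∩ AG F 𝓔 (F.flip w))).card ≤
    (Finset.univ.filter (· ∈ DG F 𝒯 w ∩ FlG F 𝓔 (F.flip w))).card +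
      (Finset.univ.filter (· ∈ DG F 𝒯 (F.flip w) ∩ FlG F 𝓔 w)).card := by
  have h1 := card_DG_AG_le h𝒯 h𝓔 w
  have h2 := card_DG_AG_le h𝒯 h𝓔 (F.flip w)
  have r := card_rearrG (DG_flip_subset h𝒯 hw) (FlG_subset_flip h𝓔 hw)
  omega

end Core

end CrossArm

end Summit.Ventures.PercRepro2
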